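import Mathlib
import HarnessLib
import Literature.Computability.AlgebraicComplexity.StandardFamilies
import Literature.ModelTheory.FiniteModelTheory.StructCkEquiv
import Summits.ValiantsHypothesis.ValiantsHypothesis.Theorems.SymmetryDialAffineCFIRung

/-!
# SymmetryDial — the affine pebble game behind `AffineCFIPairs` (route `SymmetryDial`, item 23711)

Workshop `decomp-valiant`, lens 1, gen 5.  After rev 3 of `Theorems/SymmetryDialAffineCFISplit.lean`
the route item A₂ = `SymHardAffineSupported` follows from P = `AffineCFIPairs` ALONE
(`symHardAffineSupported_of_cfiPairs`).  This file types the finite-model-theory object that P is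
really about, so that the census instrument T6′ (bijective `k′`-pebble game / `k′`-WL on the two-sorted
affine matrix structures, NODE-g5 §10–§11) reads in kernel currency:

* `affStr A` — the **affine matrix structure** `𝔄_d(A)` of a `0/1` matrix `A : 𝔽₂^d × 𝔽₂^d → {0,1}`:
  universe `𝔽₂^d ⊕ 𝔽₂^d` = points ⊕ dual vectors (hyperplane directions), relations `pt`, `dl` (the
  sorts), `aff(a,b,c,e) :⇔ a + b + c = e` (whose automorphism group on points is exactly `AGL_d(𝔽₂)`,
  the route's group), `inc(ξ,a,b) :⇔ ξ(a + b) = 0` (a, b in the same coset of `ker ξ`; this sort names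
  the subgroups `W` of the flag-let supports `Fix(U,W)`), `mat(a,b) :⇔ A(a,b) = 1`.  A `def`, not an
  instance (used through `@`).
* `AffinePebbleEquiv k′ d A B` := `StructCkEquiv Laff k′` of `𝔄_d(A)` and `𝔄_d(B)` (Hella's bijective
  `k′`-pebble game, the tree's `Literature.ModelTheory.FiniteModelTheory.StructCkEquiv`).
* `AffinePebblePairs` (P′): for every `k′` some dimension carries two `0/1` matrices with different
  `0/1`-permanents whose affine matrix structures are `C^{k′}`-equivalent — the affine
  Cai–Fürer–Immerman statement in its native logical form (OPEN; T6′-F1′ is its first census row).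
* PROVED here: `affinePebbleEquiv_zero` (k′ = 0 is no constraint), `affinePebbleEquiv_mono`,
  `affinePebbleEquiv_refl`, the rungs `affinePebblePairs_rung_zero` (k′ = 0, d = 2, the matrices of
  `SymmetryDialAffineCFIRung`) and `affinePebblePairs_rung_one` (k′ = 1, d = 1: ONE pebble pair only sees
  the sorts and the diagonal — `affinePebbleEquiv_one_of_diag_eq`, Duplicator's identity strategy).
  VISIBILITY NOTE for the census: `aff` is equality-definable on tuples with a repeated entry, so the
  affine structure is invisible below `4` pebble pairs (`inc` below `3`); meaningful rows start at k′ = 4.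
* The TRANSFER statement `AffineLogicTransfer` (admissible circuits of flag-let budget `k`, any size, do
  not distinguish `C^{k′(k)}`-equivalent affine matrix structures — the affine, any-size form of the
  Anderson–Dawar simulation of supported symmetric circuits in bounded-variable counting logic) and the
  glue `AffineLogicTransfer → AffinePebblePairs → AffineCFIPairs` live in rev 4 of the split file, which
  can import this one.

LADDER-Valiant rung 0: nothing here bears on VP ≠ VNP.  References: Hella 1996; Atserias–Dawar 2019
§2.1; Anderson–Dawar 2017 (Thm 4, supports ⇒ FPC); Dawar–Wilsenach 2025 §7 (arXiv:2503.15523v2).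
-/

set_option linter.dupNamespace false

namespace Summit.ValiantsHypothesis.ValiantsHypothesis.Theorems.SymmetryDialAffinePebble

open Literature.Computability.AlgebraicComplexity
open Literature.ModelTheory.FiniteModelTheory

/-- The index set `𝔽₂^d` (points; also used as coordinates of dual vectors). -/
abbrev V (d : ℕ) : Type := Fin d → Fin 2

/-- **Relation symbols of the affine matrix language**: two sort predicates, the affine 4-ary
relation on points, incidence of a dual vector with a pair of points, and the matrix. -/
inductive AffRel : ℕ → Type
  | pt : AffRel 1
  | dl : AffRel 1
  | aff : AffRel 4
  | inc : AffRel 3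
  | mat : AffRel 2

/-- The (relational) affine matrix language. -/
def Laff : FirstOrder.Language := ⟨fun _ => Empty, AffRel⟩

/-- The pairing of a dual vector (in coordinates) with a point: `ξ(v) = Σ ξᵢ vᵢ ∈ 𝔽₂`. -/
def pair {d : ℕ} (ξ v : V d) : Fin 2 := ∑ i, ξ i * v i

/-- Interpretation of the relation symbols on the universe `points ⊕ dual vectors`. -/
def RelHolds {d : ℕ} (A : V d × V d → Bool) : {n : ℕ} → AffRel n → (Fin n → V d ⊕ V d) → Prop
  | _, .pt, xs => ∃ a : V d, xs 0 = .inl a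
  | _, .dl, xs => ∃ ξ : V d, xs 0 = .inr ξ
  | _, .aff, xs => ∃ a b c e : V d,
      xs 0 = .inl a ∧ xs 1 = .inl b ∧ xs 2 = .inl c ∧ xs 3 = .inl e ∧ a + b + c = e
  | _, .inc, xs => ∃ ξ a b : V d, xs 0 = .inr ξ ∧ xs 1 = .inl a ∧ xs 2 = .inl b ∧ pair ξ (a + b) = 0
  | _, .mat, xs => ∃ a b : V d, xs 0 = .inl a ∧ xs 1 = .inl b ∧ A (a, b) = true

/-- **The affine matrix structure `𝔄_d(A)`** on `𝔽₂^d ⊕ 𝔽₂^d` (a `def`, used through `@`). -/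
@[reducible] def affStr {d : ℕ} (A : V d × V d → Bool) : Laff.Structure (V d ⊕ V d) where
  funMap := fun {_} f => Empty.elim f
  RelMap := fun {_} r xs => RelHolds A r xs

/-- **`C^{k′}`-equivalence of affine matrix structures** (the bijective `k′`-pebble game on
`𝔄_d(A)`, `𝔄_d(B)`). -/
def AffinePebbleEquiv (k' d : ℕ) (A B : V d × V d → Bool) : Prop :=
  @StructCkEquiv Laff k' (V d ⊕ V d) (V d ⊕ V d) (affStr A) (affStr B)

/-- **P′ — affine pebble pairs** (the affine CFI statement in logical form, OPEN): for every number of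
pebble pairs `k′` some dimension `d` carries `0/1` matrices `A, B` on `𝔽₂^d × 𝔽₂^d` with
`𝔄_d(A) ≡_{C^{k′}} 𝔄_d(B)` and different `0/1`-permanents. -/
def AffinePebblePairs : Prop :=
  ∀ k' : ℕ, ∃ (d : ℕ) (A B : V d × V d → Bool), AffinePebbleEquiv k' d A B ∧
    MvPolynomial.eval (fun ij => if A ij = true then (1 : ℂ) else 0) (perPoly (V d) ℂ) ≠
      MvPolynomial.eval (fun ij => if B ij = true then (1 : ℂ) else 0) (perPoly (V d) ℂ)

/-! ### Sanity: the game is a genuine, monotone constraint, trivial at `k′ = 0` -/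

/-- Every relation symbol of `Laff` has positive arity. -/
theorem affRel_arity_pos {n : ℕ} (r : AffRel n) : 0 < n := by
  cases r <;> decide

/-- **`k′ = 0` is no constraint**: with no pebbles every position is the empty one, which is a
partial isomorphism because `Laff` has no `0`-ary symbols. -/
theorem affinePebbleEquiv_zero (d : ℕ) (A B : V d × V d → Bool) : AffinePebbleEquiv 0 d A B := by
  refine ⟨⟨{PebblePosition.empty}, rfl, fun p _ i => i.elim0⟩, ?_⟩
  intro p hp
  have hp' : p = PebblePosition.empty := hp
  subst hp'
  refine ⟨fun a a' b b' h _ => ?_, fun r R a b h => ?_⟩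
  · exact absurd h (PebblePosition.not_pebbled_empty a b)
  · exact absurd (h ⟨0, affRel_arity_pos R⟩) (PebblePosition.not_pebbled_empty _ _)

/-- Monotonicity in the number of pebbles. -/
theorem affinePebbleEquiv_mono {j k' d : ℕ} (hjk : j ≤ k') {A B : V d × V d → Bool}
    (h : AffinePebbleEquiv k' d A B) : AffinePebbleEquiv j d A B :=
  @StructCkEquiv.mono Laff (V d ⊕ V d) (V d ⊕ V d) (affStr A) (affStr B) j k' hjk h

/-- Reflexivity (Duplicator copies). -/
theorem affinePebbleEquiv_refl (k' d : ℕ) (A : V d × V d → Bool) : AffinePebbleEquiv k' d A A :=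
  @StructCkEquiv.of_equiv Laff (V d ⊕ V d) (V d ⊕ V d) (affStr A) (affStr A)
    (@FirstOrder.Language.Equiv.refl Laff (V d ⊕ V d) (affStr A)) k'

/-- **Rung R₀ of P′** (`k′ = 0`, `d = 2`): the matrices of `SymmetryDialAffineCFIRung` have different
`0/1`-permanents, and `0` pebbles never distinguish anything. -/
theorem affinePebblePairs_rung_zero :
    ∃ (d : ℕ) (A B : V d × V d → Bool), AffinePebbleEquiv 0 d A B ∧
      MvPolynomial.eval (fun ij => if A ij = true then (1 : ℂ) else 0) (perPoly (V d) ℂ) ≠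
        MvPolynomial.eval (fun ij => if B ij = true then (1 : ℂ) else 0) (perPoly (V d) ℂ) := by
  obtain ⟨A, B, -, hper⟩ := SymmetryDialAffineCFIRung.affineCFIPairs_rung_zero
  exact ⟨2, A, B, affinePebbleEquiv_zero 2 A B, hper⟩


/-! ### Rung R₁ of P′: one pebble pair sees only the sorts and the diagonal of the matrix -/

section RungOne

/-- The `0/1`-permanent as a count of permutations inside the matrix (any finite index type). -/
theorem eval_perPoly_eq_card {I : Type} [Fintype I] [DecidableEq I] (x : I × I → Bool) :
    MvPolynomial.eval (fun ij => if x ij = true then (1 : ℂ) else 0) (perPoly I ℂ) =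
      ((Finset.univ.filter fun σ : Equiv.Perm I => ∀ i, x (σ i, i) = true).card : ℂ) := by
  simp only [perPoly, Matrix.permanent, map_sum, map_prod, Matrix.mvPolynomialX_apply,
    MvPolynomial.eval_X]
  rw [← Finset.sum_boole]
  refine Finset.sum_congr rfl fun σ _ => ?_
  exact Fintype.prod_boole

/-- Duplicator's IDENTITY strategy: the positions all of whose pebbled pairs are diagonal. -/
def diagPositions (M : Type) (k : ℕ) : Set (PebblePosition k M M) :=
  {p | ∀ i (x y : M), p i = some (x, y) → x = y}

/-- **One pebble pair cannot tell apart two matrices with the same diagonal**: Duplicator answers every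
move with the identity bijection; a single pebbled pair `(x, x)` only ever inspects relations on the
constant tuple `(x, …, x)`, i.e. the sorts and the diagonal entry `A(x,x)`. -/
theorem affinePebbleEquiv_one_of_diag_eq {d : ℕ} (A B : V d × V d → Bool)
    (hdiag : ∀ a : V d, A (a, a) = B (a, a)) : AffinePebbleEquiv 1 d A B := by
  refine ⟨⟨diagPositions (V d ⊕ V d) 1, ?_, ?_⟩, ?_⟩
  · intro i x y h
    simp [PebblePosition.empty] at h
  · intro p hp i
    refine ⟨Equiv.refl _, fun a j x y h => ?_⟩
    by_cases hji : j = i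
    · subst hji
      rw [Function.update_self] at h
      simp only [Equiv.refl_apply, Option.some.injEq, Prod.mk.injEq] at h
      rw [← h.1, ← h.2]
    · rw [Function.update_of_ne hji] at h
      exact hp j x y h
  · intro p hp
    -- with one pebble pair, all pebbled pairs coincide and are diagonal
    have hpair : ∀ {a b : V d ⊕ V d}, p.Pebbled a b → p 0 = some (a, a) ∧ b = a := by
      rintro a b ⟨i, hi⟩
      have hi0 : i = 0 := Subsingleton.elim _ _
      subst hi0
      have hab : a = b := hp 0 a b hi
      subst hab
      exact ⟨hi, rfl⟩
    refine ⟨fun a a' b b' h h' => ?_, fun r R a b h => ?_⟩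
    · rw [(hpair h).2, (hpair h').2]
    · have hb : b = a := funext fun j => (hpair (h j)).2
      rw [hb]
      have hconst : ∀ j j' : Fin r, a j = a j' := by
        intro j j'
        have h1 := (hpair (h j)).1
        have h2 := (hpair (h j')).1
        rw [h1] at h2
        simpa using h2
      cases R with
      | pt => exact Iff.rfl
      | dl => exact Iff.rfl
      | aff => exact Iff.rfl
      | inc => exact Iff.rfl
      | mat =>
        show (∃ x y : V d, a 0 = .inl x ∧ a 1 = .inl y ∧ A (x, y) = true) ↔
          (∃ x y : V d, a 0 = .inl x ∧ a 1 = .inl y ∧ B (x, y) = true)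
        have h10 : a 1 = a 0 := hconst 1 0
        constructor
        · rintro ⟨x, y, hx, hy, hA⟩
          have hxy : y = x := by rw [h10, hx] at hy; exact (Sum.inl_injective hy).symm
          subst hxy
          exact ⟨y, y, hx, hy, by rw [← hdiag]; exact hA⟩
        · rintro ⟨x, y, hx, hy, hB⟩
          have hxy : y = x := by rw [h10, hx] at hy; exact (Sum.inl_injective hy).symm
          subst hxy
          exact ⟨y, y, hx, hy, by rw [hdiag]; exact hB⟩

/-- The `2 × 2` identity matrix on `𝔽₂¹ × 𝔽₂¹` (`per = 1`). -/
def idMat (p : V 1 × V 1) : Bool := decide (p.1 = p.2)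

/-- The `2 × 2` all-ones matrix (`per = 2`); same diagonal as `idMat`. -/
def onesMat (_ : V 1 × V 1) : Bool := true

/-- `per idMat = 1`. -/
theorem card_idMat : (Finset.univ.filter fun σ : Equiv.Perm (V 1) => ∀ i, idMat (σ i, i) = true).card = 1 := by
  rw [Finset.card_eq_one]
  refine ⟨1, Finset.eq_singleton_iff_unique_mem.2 ⟨by simp [idMat], fun σ hσ => ?_⟩⟩
  ext i : 1
  simpa [idMat] using (Finset.mem_filter.1 hσ).2 i

/-- `per onesMat = 2`. -/
theorem card_onesMat :
    (Finset.univ.filter fun σ : Equiv.Perm (V 1) => ∀ i, onesMat (σ i, i) = true).card = 2 := by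
  rw [Finset.filter_true_of_mem fun σ _ i => rfl, Finset.card_univ, Fintype.card_perm]
  rfl

/-- **Rung R₁ of P′** (`k′ = 1`, `d = 1`): the identity and the all-ones `2 × 2` matrices agree on the
diagonal (so one pebble pair cannot separate their affine matrix structures) and have `0/1`-permanents
`1 ≠ 2`. -/
theorem affinePebblePairs_rung_one :
    ∃ (d : ℕ) (A B : V d × V d → Bool), AffinePebbleEquiv 1 d A B ∧
      MvPolynomial.eval (fun ij => if A ij = true then (1 : ℂ) else 0) (perPoly (V d) ℂ) ≠
        MvPolynomial.eval (fun ij => if B ij = true then (1 : ℂ) else 0) (perPoly (V d) ℂ) := by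
  refine ⟨1, idMat, onesMat, affinePebbleEquiv_one_of_diag_eq idMat onesMat fun a => by simp [idMat, onesMat], ?_⟩
  rw [eval_perPoly_eq_card, eval_perPoly_eq_card, card_idMat, card_onesMat]
  norm_num

end RungOne

end Summit.ValiantsHypothesis.ValiantsHypothesis.Theorems.SymmetryDialAffinePebble
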